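import Summits.Langlands.Langlands.Theorems.IrreducibilityBySelfDualityGaloisRepOfRegularAlgebraicLocalRigidity
import HarnessLib

/-!
# Line `Sketch` for the crux `ReciprocityUpToIrreducibility` (item stmt-Langlands-14328), wave N14-A:
# a rank-one `ℓ`-adic representation has finite inertia image at every place `v ∤ ℓ`

Support file (closes nothing; stub `stub_rankOne_finite_inertia_away` of the registered skeleton of
line `Sketch`, continuation lead c9).

Let `K` be a number field, `ℓ` a prime, `ρ : Γ_K →ₜ* GL_1(ℚ̄_ℓ)` a continuous character and `v ∤ ℓ`
a finite place.  Then the image of the local inertia group `I_{K_v} ≤ Γ_{K_v}` under the local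
representation `ρ|_{Γ_{K_v}}` (`FramedGaloisRep.toLocal`) is finite.  This is the rank-one case of
Grothendieck's `ℓ`-adic monodromy theorem, which is PROVED in the tree
(`FramedRep.exists_isOpen_isNilpotent_sub_one_holds`, Serre–Tate 1968, Appendix; Deligne, Antwerp II,
§8.4.2): the restriction `ρ|_{W_{K_v}}` of `ρ` to the Weil group (continuous,
`WeilGroup.continuous_toAbsGalois_holds`; `‖q_v‖_ℓ = 1` because `v ∤ ℓ`,
`GaloisRepOfRegularAlgebraic.norm_residueCard_eq_one`) is unipotent on an open subgroup `U` of the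
inertia group `I(W_{K_v})`; a unipotent `1 × 1` matrix is `1` (a nilpotent `1 × 1` matrix over a
field vanishes, `Ladic.pow_eq_zero_of_isNilpotent`), so `ρ` kills `U`; `I(W_{K_v})` is compact
(`WeilGroup.isCompact_inertia_holds`) and `W_{K_v}` a topological group
(`WeilGroup.isTopologicalGroup_holds`), so finitely many cosets `x U` cover it and `ρ(I(W_{K_v}))` is
finite (`finite_image_inertia_of_forall_eq_one`, the argument of the tree's
`WeilDeligneRep.finite_image_inertia`); finally the Weil group's inertia maps ONTO the Galois
inertia group `I_{K_v}` (`WeilGroup.inertia_map_toAbsGalois`).  No definitions; standard axioms; no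
named fact is assumed.

References: J.-P. Serre, J. Tate, *Good reduction of abelian varieties*, Ann. of Math. 88 (1968),
Appendix [SerreTate1968]; P. Deligne, *Les constantes des équations fonctionnelles des fonctions L*,
Antwerp II, LNM 349 (1973), §8.4.2 [DeligneAntwerpII1973]; J. Tate, *Number theoretic background*,
Corvallis 1979, (1.4.1), (4.2.1) [TateCorvallis1979].
-/

noncomputable section

set_option linter.dupNamespace false -- project-wide option (lakefile weak.linter.dupNamespace); `Summit.Langlands.Langlands` is the mandated namespace

open scoped MatrixGroups Matrix NumberField Classical Polynomial
open Filter IsDedekindDomain Polynomial Field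
open Literature.NumberTheory.Automorphic Literature.NumberTheory.GaloisRepresentations
open Literature.NumberTheory.GaloisRepresentations.IsNonarchimedeanLocalField (residueFieldCard)
open Summit.Langlands

namespace Summit.Langlands.Langlands.Theorems.ReciprocityUpToIrreducibility

/-! ## 1. Local: finite inertia image on the Weil group, and in rank one -/

section Local

open WeilGroup

variable {F : Type} [Field F] [ValuativeRel F] [TopologicalSpace F] [IsNonarchimedeanLocalField F]

/-- **`φ(I_F)` is finite as soon as `φ` kills an open subgroup of `W_F`.**  For a homomorphism
`φ : W_F →* M` into a monoid, trivial on an open subgroup `U`, the image of the inertia group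
`I_F ≤ W_F` is finite: `I_F` is compact (`WeilGroup.isCompact_inertia_holds`) and `W_F` is a
topological group (`WeilGroup.isTopologicalGroup_holds`), so finitely many cosets `x U` cover `I_F`,
and `φ` is constant on each.  [cite: DeligneAntwerpII1973, §8.4.1] [cite: TateCorvallis1979, (1.4.1)] -/
-- adapted from `Literature.NumberTheory.GaloisRepresentations.WeilDeligneRep.finite_image_inertia`
-- (WeilDeligneRepFrobSemisimpleProofs.lean), with `r.ρ.toHomUnits` replaced by an arbitrary `φ`.
theorem finite_image_inertia_of_forall_eq_one {M : Type*} [Monoid M] (φ : WeilGroup F →* M)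
    {U : Subgroup (WeilGroup F)} (hUo : IsOpen (U : Set (WeilGroup F)))
    (hU : ∀ u ∈ U, φ u = 1) :
    ((fun w => φ w) '' (inertia F : Set (WeilGroup F))).Finite := by
  haveI : IsTopologicalGroup (WeilGroup F) := isTopologicalGroup_holds F
  have hcpt : IsCompact (inertia F : Set (WeilGroup F)) := isCompact_inertia_holds F
  obtain ⟨t, ht⟩ := hcpt.elim_finite_subcover (fun x : WeilGroup F => {y | x⁻¹ * y ∈ U})
    (fun x => hUo.preimage (continuous_const_mul x⁻¹))
    (fun y _ => Set.mem_iUnion.mpr ⟨y, by simp⟩)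
  refine (t.finite_toSet.image fun w => φ w).subset ?_
  rintro _ ⟨y, hy, rfl⟩
  obtain ⟨x, hx, hxy⟩ : ∃ x ∈ t, x⁻¹ * y ∈ U := by simpa using ht hy
  refine ⟨x, hx, ?_⟩
  calc φ x = φ x * φ (x⁻¹ * y) := by rw [hU _ hxy, mul_one]
    _ = φ y := by rw [← map_mul, mul_inv_cancel_left]

variable {E : Type} [NontriviallyNormedField E]

/-- **Grothendieck's monodromy theorem in rank one: finite inertia image.**  Let `E` be a
non-trivially normed field in which the residue cardinality `q` of `F` has norm `1` (e.g. `ℚ̄_ℓ`,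
`ℓ ∤ q`) and `ρ : Γ_F →ₜ* GL_1(E)` a continuous character.  Then `ρ(I_F)` is finite: by
Grothendieck's quasi-unipotence theorem (`FramedRep.exists_isOpen_isNilpotent_sub_one_holds`) applied
to the continuous restriction `ρ|_{W_F}` (`WeilGroup.continuous_toAbsGalois_holds`), `ρ(u) - 1` is a
nilpotent `1 × 1` matrix, hence `0` (`Ladic.pow_eq_zero_of_isNilpotent`), for `u` in an open subgroup
`U` of the inertia of `W_F`; so `ρ(I(W_F))` is finite (`finite_image_inertia_of_forall_eq_one`), and
`I(W_F)` maps onto `I_F` (`WeilGroup.inertia_map_toAbsGalois`).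
[cite: SerreTate1968, Appendix (ℓ-adic monodromy)] [cite: DeligneAntwerpII1973, §8.4.2]
[cite: TateCorvallis1979, (4.2.1)] -/
theorem finite_image_absInertia_of_rankOne (hq : ‖(residueFieldCard F : E)‖ = 1)
    (ρ : FramedRep (absoluteGaloisGroup F) E 1) :
    ((fun g => ρ g) '' (absInertia F : Set (absoluteGaloisGroup F))).Finite := by
  -- the continuous restriction of `ρ` to the Weil group
  let ι : WeilGroup F →ₜ* absoluteGaloisGroup F := ⟨toAbsGalois F, continuous_toAbsGalois_holds F⟩
  let ρW : FramedRep (WeilGroup F) E 1 := ρ.comp ι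
  -- Grothendieck: `ρW` is unipotent, i.e. trivial (rank one), on an open subgroup `U` of inertia
  obtain ⟨U, -, hUo, hnil⟩ := FramedRep.exists_isOpen_isNilpotent_sub_one_holds hq ρW
  have hU1 : ∀ u ∈ U, ρW.toMonoidHom u = 1 := fun u hu => by
    have h := Ladic.pow_eq_zero_of_isNilpotent (hnil u hu)
    rw [pow_one, sub_eq_zero] at h
    exact Units.ext h
  -- hence `ρW (I(W_F))` is finite, and `I(W_F) ↠ I_F`
  refine (finite_image_inertia_of_forall_eq_one ρW.toMonoidHom hUo hU1).subset ?_
  rintro _ ⟨σ, hσ, rfl⟩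
  have hσ' : σ ∈ (inertia F).map (toAbsGalois F) := by rwa [inertia_map_toAbsGalois]
  obtain ⟨w, hw, rfl⟩ := hσ'
  exact ⟨w, hw, rfl⟩

end Local

/-! ## 2. The registered stub -/

/-- **Registered stub `stub_rankOne_finite_inertia_away` of line `Sketch` (crux stmt-Langlands-14328,
wave N14-A): Grothendieck's monodromy theorem in rank one, finite inertia image away from `ℓ`.**
For a number field `K`, a prime `ℓ`, a continuous character `ρ : Γ_K →ₜ* GL_1(ℚ̄_ℓ)` and a finite
place `v ∤ ℓ`, the image of the local inertia group `I_{K_v}` under `ρ|_{Γ_{K_v}}` is finite: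
`‖q_v‖_ℓ = 1` (`GaloisRepOfRegularAlgebraic.norm_residueCard_eq_one`,
`residueFieldCard_adicCompletion_eq`) and `finite_image_absInertia_of_rankOne` (Grothendieck's
quasi-unipotence theorem `FramedRep.exists_isOpen_isNilpotent_sub_one_holds` on `ρ|_{W_{K_v}}`, a
unipotent scalar is `1`, compactness of the inertia of the Weil group, `I(W_{K_v}) ↠ I_{K_v}`).
[cite: SerreTate1968, Appendix (ℓ-adic monodromy)] [cite: DeligneAntwerpII1973, §8.4.2] -/
theorem stub_rankOne_finite_inertia_away :
    ∀ (K : Type) [Field K] [NumberField K] (ℓ : ℕ) [Fact ℓ.Prime]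
      (ρ : FramedGaloisRep K (PadicAlgCl ℓ) 1) (v : HeightOneSpectrum (𝓞 K)),
      ((ℓ : ℕ) : 𝓞 K) ∉ v.asIdeal →
      ((fun g => ρ.toLocal v g) ''
        (absInertia (v.adicCompletion K) :
          Set (Field.absoluteGaloisGroup (v.adicCompletion K)))).Finite := by
  intro K _ _ ℓ _ ρ v hv
  have hq1 : ‖((residueFieldCard (v.adicCompletion K) : ℕ) : PadicAlgCl ℓ)‖ = 1 := by
    rw [residueFieldCard_adicCompletion_eq K v]
    exact GaloisRepOfRegularAlgebraic.norm_residueCard_eq_one v hv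
  exact finite_image_absInertia_of_rankOne hq1 (ρ.toLocal v)

end Summit.Langlands.Langlands.Theorems.ReciprocityUpToIrreducibility

end
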